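import Summits.AnomalousDissipation.AnomalousDissipation.Theorems.MomentParityResolvedDissipationStubLimitSSS
import Summits.AnomalousDissipation.AnomalousDissipation.Theorems.MomentParityResolvedDissipationStubTightExtraction
import Summits.AnomalousDissipation.AnomalousDissipation.Theorems.GalerkinInvariantLoud.Negative.Clauses
import Summits.AnomalousDissipation.AnomalousDissipation.Theses.Ensemble

/-!
# `MomentParity.GalerkinInvariantLoud` (stmt-AnomalousDissipation-14283): the WORK-FORM ensemble zeroth law
# is a common necessary condition of this crux and of `Ensemble.EnsembleZerothLawSomeForce` (stmt-0214)

Supports stmt-AnomalousDissipation-14283 (no item is credited: both cruxes are open). This is the certified form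
of the "DIFFUSE corner" bookkeeping of the crux's strategy census (`Cruxes/GalerkinInvariantLoud/STRATEGY-CENSUS.md`
§0): every family of witnesses of `GalerkinInvariantLoud` at one viscosity `ν` — Borel probability laws on
`H = L²_σ(T³)` carried by level-`N` fields, supported in a ball `‖u‖ ≤ R`, invariant (all-order polynomially
stationary) for Galerkin NS at `(ν, f)`, with `∫ |u|² dμ ≤ E` and `ν ∫ ‖∇u‖² dμ ≥ ε`, at infinitely many levels
`N` — has, along `N → ∞`, a weak limit which is a stationary statistical solution of NS at `(ν, f)` in the
Foias–Manley–Rosa–Temam sense (`Torus.IsStationaryStatisticalSolution`), carried by the same ball, with mean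
energy `≤ E` and mean WORK `∫ (u, f) dμ ≥ ε`. The dissipation floor itself does NOT pass to the limit (the
enstrophy is only lower semicontinuous; its passage is exactly the sibling crux `ResolvedDissipation`, stmt-14284),
but the work does: at every level the energy row reads `ν ∫ ‖∇u‖² dμ_N = ∫ (u, f) dμ_N`
(`IsGILWitness.dissipation_eq`) and `u ↦ (u, f)` is norm-continuous and bounded on the ball.

* `ensembleEnstrophy_le_of_isGILWitness` — the `N`-uniform enstrophy budget `∫ ‖∇u‖² dμ ≤ ‖f‖₂ R / ν` of a
  witness (energy row + Cauchy–Schwarz; finite at each level by Bernstein).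
* `dissipation_le_work` — for every stationary statistical solution with finite mean energy,
  `ν ∫ ‖∇u‖² dμ ≤ ∫ (u, f) dμ` (the energy inequality (1.31) on the shell `0 ≤ |u|² < ∞`).
* `exists_workSSS_of_frequently` — at ONE viscosity: from `∃ᶠ N` witnesses, a stationary statistical solution
  carried by the ball with energy `≤ E`, work `≥ ε` and dissipation `≤` work (Rellich–Prokhorov extraction
  `stub_tightExtraction`, K2a, and the limit theorem `stub_limitIsStationarySolution`, K2b, of the
  `ResolvedDissipation` line; both landed).
* `workLaw_of_galerkinInvariantLoud` — **`GalerkinInvariantLoud ⟹ W`**, where `W` (stated inline, no new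
  definition) is the work-form ensemble zeroth law: some smooth divergence-free mean-zero `f`, viscosities
  `ν_j → 0⁺`, budgets `E`, `ε > 0`, and at every `j` a stationary statistical solution of NS at `(ν_j, f)` with
  `∫ |u|² dμ_j ≤ E` and `∫ (u, f) dμ_j ≥ ε` (the mean flow keeps an `O(1)` projection on the force at bounded
  energy, uniformly in `ν`).
* `workLaw_of_ensembleZerothLawSomeForce` — **`Ensemble.EnsembleZerothLawSomeForce ⟹ W`** (dissipation `≤` work).
* `not_galerkinInvariantLoud_of_not_workLaw`, `not_ensembleZerothLawSomeForce_of_not_workLaw` — contrapositives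
  for the negatives index: `W` is the weakest zeroth-law statement in the tree below both open cruxes; one
  refutation of `W` kills stmt-14283 and stmt-0214 (and, through the landed `galerkinInvariantLoud_of_MomentLadder`,
  the target `MomentLadder`).

References: Foias–Manley–Rosa–Temam, *Navier–Stokes Equations and Turbulence* (CUP 2001), Ch. IV §1.2
Def. 1.3 (1.29)–(1.31), Ch. IV App. B (Galerkin limits of invariant measures); Billingsley, *Convergence of
Probability Measures*, Thms 2.1, 5.1; Frisch, *Turbulence* (CUP 1995), Ch. 5 law (ii) (the zeroth law, posed).
-/

noncomputable section

-- `Summit.<Summit>.<Problem>`: single-conjunct summit, the duplicate namespace segment is mandated.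
set_option linter.dupNamespace false

namespace Summit.AnomalousDissipation.AnomalousDissipation.Theorems.GalerkinInvariantLoud.WorkLaw

open MeasureTheory Filter Topology
open scoped ENNReal NNReal
open Literature.Analysis.FunctionSpaces Literature.Analysis.FluidPDE
open Summit.AnomalousDissipation.AnomalousDissipation.Theses.MomentParity
open Summit.AnomalousDissipation.AnomalousDissipation.Theorems.QuarticGate.Negative
open Summit.AnomalousDissipation.AnomalousDissipation.Theorems.GalerkinInvariantLoud.Negative

/-! ## The `N`-uniform enstrophy budget of a witness -/

/-- **Enstrophy budget of a witness**, uniform in the level: a witness of the crux at `(f, ν, N, R, E, ε)`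
with `0 < ν` and `f ∈ L²` has `∫ ‖∇u‖² dμ ≤ ‖f‖₂ R / ν` in `ℝ≥0∞` (the energy row
`ν ∫ ‖∇u‖² dμ = ∫ (u, f) dμ ≤ ‖f‖₂ √(∫|u|²) ≤ ‖f‖₂ R`; the mean enstrophy of a bounded level-`N` law is
finite by Bernstein, so `toReal` loses nothing). [folklore] -/
theorem ensembleEnstrophy_le_of_isGILWitness {f : UnitAddTorus (Fin 3) → EuclideanSpace ℝ (Fin 3)}
    (hf : MemLp f 2 volume) {ν : ℝ} (hν : 0 < ν) {N : ℕ} {R E ε : ℝ}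
    {μ : Measure (Torus.energySpace (Fin 3))} (h : IsGILWitness f ν N R E ε μ) :
    Torus.ensembleEnstrophy μ ≤ ((Real.sqrt (∫ x, ‖f x‖ ^ 2) * R / ν).toNNReal : ℝ≥0∞) := by
  obtain ⟨hp, hl, hb, hinv, -, -⟩ := h
  haveI : (ae μ).NeBot := ae_neBot.2 (IsProbabilityMeasure.ne_zero μ)
  obtain ⟨u₀, hu₀⟩ := hb.exists
  have hR0 : 0 ≤ R := (norm_nonneg _).trans hu₀
  have h2 : Integrable (fun u : Torus.energySpace (Fin 3) => ‖u‖ ^ 2) μ :=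
    Integrable.of_bound (continuous_norm.pow 2).aestronglyMeasurable (R ^ 2) (hb.mono fun u hu => by
      rw [Real.norm_eq_abs, abs_of_nonneg (by positivity)]
      exact pow_le_pow_left₀ (norm_nonneg _) hu 2)
  have hE : Torus.ensembleEnergy μ ≤ R ^ 2 := by
    unfold Torus.ensembleEnergy
    calc ∫ u, ‖u‖ ^ 2 ∂μ ≤ ∫ _u, R ^ 2 ∂μ := integral_mono_ae h2 (integrable_const _)
          (hb.mono fun u hu => pow_le_pow_left₀ (norm_nonneg _) hu 2)
      _ = R ^ 2 := by simp
  have hdiss : Torus.ensembleDissipation ν μ ≤ Real.sqrt (∫ x, ‖f x‖ ^ 2) * R := by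
    rw [ensembleDissipation_eq_of_polyStationary f hf hl h2 le_rfl (hinv.isPolyStationary 3)]
    refine (Theorems.CubicParityLoud.Negative.integral_pairing_le hf h2).trans ?_
    gcongr
    calc Real.sqrt (Torus.ensembleEnergy μ) ≤ Real.sqrt (R ^ 2) := Real.sqrt_le_sqrt hE
      _ = R := Real.sqrt_sq hR0
  have hne : Torus.ensembleEnstrophy μ ≠ ⊤ := by
    have h1 := ensembleEnstrophy_le_of_level hl
    have h3 : ∫⁻ u : Torus.energySpace (Fin 3), ‖u‖ₑ ^ 2 ∂μ ≤
        ∫⁻ _u : Torus.energySpace (Fin 3), ENNReal.ofReal (R ^ 2) ∂μ :=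
      lintegral_mono_ae (hb.mono fun u hu => by
        rw [← ofReal_norm, ← ENNReal.ofReal_pow (norm_nonneg _)]
        exact ENNReal.ofReal_le_ofReal (pow_le_pow_left₀ (norm_nonneg _) hu 2))
    rw [lintegral_const, measure_univ, mul_one] at h3
    exact ne_top_of_le_ne_top
      (ENNReal.mul_ne_top ENNReal.ofReal_ne_top (ne_top_of_le_ne_top ENNReal.ofReal_ne_top h3)) h1
  unfold Torus.ensembleDissipation at hdiss
  rw [← ENNReal.ofReal_toReal hne]
  refine ENNReal.ofReal_le_ofReal ?_
  rw [le_div_iff₀ hν, mul_comm]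
  exact hdiss

/-! ## Dissipation never exceeds work for a stationary statistical solution -/

/-- **Dissipation ≤ work** for stationary statistical solutions (FMRT 2001, Ch. IV (1.31) with `e₁ = 0`,
`e₂ = ∞`): if `μ` is a stationary statistical solution of NS at `(ν, f)`, `f ∈ L²`, with finite mean energy,
then `ν ∫ ‖∇u‖² dμ ≤ ∫ (u, f) dμ`. [folklore] -/
theorem dissipation_le_work {ν : ℝ} {f : UnitAddTorus (Fin 3) → EuclideanSpace ℝ (Fin 3)}
    (hf : MemLp f 2 volume) {μ : Measure (Torus.energySpace (Fin 3))}
    (hS : Torus.IsStationaryStatisticalSolution ν f μ)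
    (h2 : Integrable (fun u : Torus.energySpace (Fin 3) => ‖u‖ ^ 2) μ) :
    Torus.ensembleDissipation ν μ ≤ ∫ u, Torus.pairing u.1 f ∂μ := by
  haveI := hS.prob
  have hfin : ∫⁻ u, Torus.eGradNormSq (u.1 : UnitAddTorus (Fin 3) → EuclideanSpace ℝ (Fin 3)) ∂μ ≠ ⊤ :=
    hS.enstrophy_finite.ne
  set Z : Torus.energySpace (Fin 3) → ℝ := fun u =>
    (Torus.eGradNormSq (u.1 : UnitAddTorus (Fin 3) → EuclideanSpace ℝ (Fin 3))).toReal with hZ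
  have hZint : Integrable Z μ :=
    integrable_toReal_of_lintegral_ne_top Torus.measurable_eGradNormSq_coe.aemeasurable hfin
  have h1 : Integrable (fun u : Torus.energySpace (Fin 3) => ‖u‖) μ := integrable_norm_of_norm_sq h2
  have hPint : Integrable (fun u : Torus.energySpace (Fin 3) => Torus.pairing u.1 f) μ :=
    Theorems.CubicParityLoud.Negative.integrable_pairing hf h1
  -- (1.31) on the whole space
  have hineq := hS.energy_ineq 0 ⊤ ENNReal.zero_lt_top
  have hset : {u : Torus.energySpace (Fin 3) | (0 : ℝ≥0∞) ≤ ‖u‖ₑ ^ 2 ∧ ‖u‖ₑ ^ 2 < ⊤} = Set.univ :=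
    Set.eq_univ_of_forall fun u => ⟨bot_le, ENNReal.pow_lt_top enorm_lt_top⟩
  rw [hset, Measure.restrict_univ] at hineq
  have hsplit : ∫ u, (ν * Z u - Torus.pairing u.1 f) ∂μ = ν * ∫ u, Z u ∂μ - ∫ u, Torus.pairing u.1 f ∂μ := by
    rw [integral_sub (hZint.const_mul ν) hPint, integral_const_mul]
  rw [hsplit] at hineq
  have hD : Torus.ensembleDissipation ν μ = ν * ∫ u, Z u ∂μ := by
    unfold Torus.ensembleDissipation Torus.ensembleEnstrophy
    rw [hZ, integral_toReal Torus.measurable_eGradNormSq_coe.aemeasurable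
      (ae_lt_top Torus.measurable_eGradNormSq_coe hfin)]
  rw [hD]
  linarith

/-! ## At one viscosity: a stationary statistical solution doing work `≥ ε` -/

/-- **Loud-in-work stationary statistical solutions from the witnesses at one viscosity.** Let `f` be smooth,
`0 < ν`, and suppose that for infinitely many levels `N` there is a witness of the crux at `(f, ν, N, R, E, ε)`.
Then there is a stationary statistical solution `μ` of NS at `(ν, f)` (FMRT Ch. IV Def. 1.3), carried by the
ball `‖u‖ ≤ R`, with `∫ |u|² dμ ≤ E`, mean work `∫ (u, f) dμ ≥ ε` and `ν ∫ ‖∇u‖² dμ ≤ ∫ (u, f) dμ`. Proof: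
extract levels `N_i → ∞` from `∃ᶠ`; the energy row gives the `N`-uniform enstrophy budget `‖f‖₂ R / ν`;
Rellich–Prokhorov extraction on `H` (`stub_tightExtraction`) gives a weakly convergent subsequence whose limit
is a stationary statistical solution (`stub_limitIsStationarySolution`); the energy passes as a continuous
functional bounded on the carrier, and the work `∫ (u, f) dμ_{N_i} = ν ∫ ‖∇u‖² dμ_{N_i} ≥ ε` passes because
`u ↦ (u, f)` is continuous and bounded on the ball. [folklore] -/
theorem exists_workSSS_of_frequently
    {f : UnitAddTorus (Fin 3) → EuclideanSpace ℝ (Fin 3)} (hfs : Torus.IsSmooth f)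
    {ν : ℝ} (hν : 0 < ν) {R E ε : ℝ}
    (h : ∃ᶠ N in atTop, ∃ μ : Measure (Torus.energySpace (Fin 3)), IsGILWitness f ν N R E ε μ) :
    ∃ μ : Measure (Torus.energySpace (Fin 3)),
      Torus.IsStationaryStatisticalSolution ν f μ ∧
      Integrable (fun u : Torus.energySpace (Fin 3) => ‖u‖ ^ 2) μ ∧
      (∀ᵐ u ∂μ, ‖u‖ ≤ R) ∧
      Torus.ensembleEnergy μ ≤ E ∧ ε ≤ ∫ u, Torus.pairing u.1 f ∂μ ∧
      Torus.ensembleDissipation ν μ ≤ ∫ u, Torus.pairing u.1 f ∂μ := by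
  have hf : MemLp f 2 volume := hfs.memLp 2
  -- levels `N_i → ∞` carrying witnesses
  obtain ⟨Ns, hNs, hP⟩ := extraction_of_frequently_atTop h
  choose μ hW using hP
  have hp : ∀ i, IsProbabilityMeasure (μ i) := fun i => (hW i).1
  have hl : ∀ i, ∀ᵐ u ∂(μ i), IsLevel (Ns i) u := fun i => (hW i).2.1
  have hb : ∀ i, ∀ᵐ u ∂(μ i), ‖u‖ ≤ R := fun i => (hW i).2.2.1
  have hinv : ∀ i, IsInvariant ν f (Ns i) (μ i) := fun i => (hW i).2.2.2.1
  have hE : ∀ i, Torus.ensembleEnergy (μ i) ≤ E := fun i => (hW i).2.2.2.2.1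
  have hε : ∀ i, ε ≤ Torus.ensembleDissipation ν (μ i) := fun i => (hW i).2.2.2.2.2
  -- the `N`-uniform enstrophy budget
  have hM : ∀ i, Torus.ensembleEnstrophy (μ i) ≤ ((Real.sqrt (∫ x, ‖f x‖ ^ 2) * R / ν).toNNReal : ℝ≥0∞) :=
    fun i => ensembleEnstrophy_le_of_isGILWitness hf hν (hW i)
  -- Rellich–Prokhorov extraction (K2a)
  obtain ⟨φ, hφ, μlim, hplim, hball, hBC, hLSC, -, hPI⟩ :=
    MomentParityResolvedDissipation.TightExtraction.stub_tightExtraction R _ μ hp hb hM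
  haveI := hplim
  -- the limit is a stationary statistical solution (K2b)
  have hSSS : Torus.IsStationaryStatisticalSolution ν f μlim :=
    MomentParityResolvedDissipation.LimitSSS.stub_limitIsStationarySolution ν f R hν hf (Ns ∘ φ)
      (fun i => μ (φ i)) (fun i => hp (φ i)) (fun i => hl (φ i)) (fun i => hb (φ i))
      (fun i d => (hinv (φ i)).isPolyStationary d) (hNs.tendsto_atTop.comp hφ.tendsto_atTop)
      μlim hplim hball hBC hLSC
  -- finite energy of the limit (carried by the ball)
  have h2 : Integrable (fun u : Torus.energySpace (Fin 3) => ‖u‖ ^ 2) μlim :=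
    Integrable.of_bound (continuous_norm.pow 2).aestronglyMeasurable (R ^ 2) (hball.mono fun u hu => by
      rw [Real.norm_eq_abs, abs_of_nonneg (by positivity)]
      exact pow_le_pow_left₀ (norm_nonneg _) hu 2)
  -- energy ceiling of the limit (clipping on the carrier)
  have hEn : Torus.ensembleEnergy μlim ≤ E := by
    have ht : Tendsto (fun i => ∫ u, ‖u‖ ^ 2 ∂(μ (φ i))) atTop (𝓝 (∫ u, ‖u‖ ^ 2 ∂μlim)) :=
      MomentParityResolvedDissipation.TightExtraction.tendsto_integral_of_forall_bounded_continuous hBC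
        (S := {u | ‖u‖ ≤ R}) hball (fun i => hb (φ i)) (continuous_norm.pow 2) (B := R ^ 2) fun u hu => by
          rw [abs_of_nonneg (by positivity)]
          exact pow_le_pow_left₀ (norm_nonneg _) hu 2
    exact le_of_tendsto' ht fun i => hE (φ i)
  -- the work floor passes to the limit: at every level, work = dissipation ≥ ε
  have hW_lim : ε ≤ ∫ u, Torus.pairing u.1 f ∂μlim := by
    refine ge_of_tendsto' (hPI f hf) fun i => ?_
    rw [← (hW (φ i)).dissipation_eq hf]
    exact hε (φ i)
  exact ⟨μlim, hSSS, h2, hball, hEn, hW_lim, dissipation_le_work hf hSSS h2⟩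

/-! ## The work-form ensemble zeroth law below both cruxes -/

/-- **`GalerkinInvariantLoud ⟹ W` (work-form ensemble zeroth law).** If the crux holds — loud bounded
Galerkin-invariant ensembles along `ν_j → 0` for some smooth force — then for the SAME force, viscosities and
budgets there is at every `j` a stationary statistical solution of NS at `(ν_j, f)` (FMRT Ch. IV Def. 1.3) with
finite mean energy `∫ |u|² dμ_j ≤ E` whose mean flow does work `∫ (u, f) dμ_j ≥ ε`: the zeroth law in its weakest
(work) form, uniformly in `ν`, for an autonomous smooth force. The converse is not claimed (a stationary
statistical solution need not be a limit of bounded Galerkin-invariant laws, and work `≥ ε` does not give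
dissipation `≥ ε`). [folklore] -/
theorem workLaw_of_galerkinInvariantLoud :
    GalerkinInvariantLoud →
      ∃ f : UnitAddTorus (Fin 3) → EuclideanSpace ℝ (Fin 3),
        Torus.IsSmooth f ∧ Torus.IsDivFree f ∧ Torus.HasZeroMean f ∧
        ∃ (ν : ℕ → ℝ) (E ε : ℝ), (∀ j, 0 < ν j) ∧ Tendsto ν atTop (𝓝 0) ∧ 0 < ε ∧
          ∀ j : ℕ, ∃ μ : Measure (Torus.energySpace (Fin 3)),
            Torus.IsStationaryStatisticalSolution (ν j) f μ ∧
            Integrable (fun u : Torus.energySpace (Fin 3) => ‖u‖ ^ 2) μ ∧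
            Torus.ensembleEnergy μ ≤ E ∧ ε ≤ ∫ u, Torus.pairing u.1 f ∂μ := by
  intro h
  obtain ⟨f, hfs, hfd, hfm, ν, E, ε, hν, hν0, hε, hj⟩ := galerkinInvariantLoud_iff.1 h
  refine ⟨f, hfs, hfd, hfm, ν, E, ε, hν, hν0, hε, fun j => ?_⟩
  obtain ⟨R, hfreq⟩ := hj j
  obtain ⟨μ, hS, h2, -, hE, hWk, -⟩ := exists_workSSS_of_frequently hfs (hν j) hfreq
  exact ⟨μ, hS, h2, hE, hWk⟩

/-- **`Ensemble.EnsembleZerothLawSomeForce ⟹ W`.** The measure-form zeroth law of route Ensemble (stmt-0214: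
stationary statistical solutions with bounded energy and dissipation `ν_j ∫ ‖∇u‖² dμ_j ≥ ε` along `ν_j → 0`)
implies the work form, because dissipation never exceeds work (`dissipation_le_work`, FMRT IV (1.31)).
[folklore] -/
theorem workLaw_of_ensembleZerothLawSomeForce :
    Summit.AnomalousDissipation.AnomalousDissipation.Theses.Ensemble.EnsembleZerothLawSomeForce →
      ∃ f : UnitAddTorus (Fin 3) → EuclideanSpace ℝ (Fin 3),
        Torus.IsSmooth f ∧ Torus.IsDivFree f ∧ Torus.HasZeroMean f ∧
        ∃ (ν : ℕ → ℝ) (E ε : ℝ), (∀ j, 0 < ν j) ∧ Tendsto ν atTop (𝓝 0) ∧ 0 < ε ∧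
          ∀ j : ℕ, ∃ μ : Measure (Torus.energySpace (Fin 3)),
            Torus.IsStationaryStatisticalSolution (ν j) f μ ∧
            Integrable (fun u : Torus.energySpace (Fin 3) => ‖u‖ ^ 2) μ ∧
            Torus.ensembleEnergy μ ≤ E ∧ ε ≤ ∫ u, Torus.pairing u.1 f ∂μ := by
  rintro ⟨f, hfs, hfd, hfm, ν, μ, hν, hν0, hS, hI, ⟨E, hE⟩, ε, hε, hD⟩
  refine ⟨f, hfs, hfd, hfm, ν, E, ε, hν, hν0, hε, fun j => ⟨μ j, hS j, hI j, hE j, ?_⟩⟩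
  exact (hD j).trans (dissipation_le_work (hfs.memLp 2) (hS j) (hI j))

/-- Contrapositive for the negatives index: a refutation of the work-form ensemble zeroth law `W` refutes the
crux `GalerkinInvariantLoud` (stmt-AnomalousDissipation-14283). [folklore] -/
theorem not_galerkinInvariantLoud_of_not_workLaw
    (hW : ¬ ∃ f : UnitAddTorus (Fin 3) → EuclideanSpace ℝ (Fin 3),
        Torus.IsSmooth f ∧ Torus.IsDivFree f ∧ Torus.HasZeroMean f ∧
        ∃ (ν : ℕ → ℝ) (E ε : ℝ), (∀ j, 0 < ν j) ∧ Tendsto ν atTop (𝓝 0) ∧ 0 < ε ∧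
          ∀ j : ℕ, ∃ μ : Measure (Torus.energySpace (Fin 3)),
            Torus.IsStationaryStatisticalSolution (ν j) f μ ∧
            Integrable (fun u : Torus.energySpace (Fin 3) => ‖u‖ ^ 2) μ ∧
            Torus.ensembleEnergy μ ≤ E ∧ ε ≤ ∫ u, Torus.pairing u.1 f ∂μ) :
    ¬ GalerkinInvariantLoud :=
  fun h => hW (workLaw_of_galerkinInvariantLoud h)

/-- Contrapositive for the negatives index: a refutation of the work-form ensemble zeroth law `W` refutes the
crux `Ensemble.EnsembleZerothLawSomeForce` (stmt-AnomalousDissipation-0214). [folklore] -/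
theorem not_ensembleZerothLawSomeForce_of_not_workLaw
    (hW : ¬ ∃ f : UnitAddTorus (Fin 3) → EuclideanSpace ℝ (Fin 3),
        Torus.IsSmooth f ∧ Torus.IsDivFree f ∧ Torus.HasZeroMean f ∧
        ∃ (ν : ℕ → ℝ) (E ε : ℝ), (∀ j, 0 < ν j) ∧ Tendsto ν atTop (𝓝 0) ∧ 0 < ε ∧
          ∀ j : ℕ, ∃ μ : Measure (Torus.energySpace (Fin 3)),
            Torus.IsStationaryStatisticalSolution (ν j) f μ ∧
            Integrable (fun u : Torus.energySpace (Fin 3) => ‖u‖ ^ 2) μ ∧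
            Torus.ensembleEnergy μ ≤ E ∧ ε ≤ ∫ u, Torus.pairing u.1 f ∂μ) :
    ¬ Summit.AnomalousDissipation.AnomalousDissipation.Theses.Ensemble.EnsembleZerothLawSomeForce :=
  fun h => hW (workLaw_of_ensembleZerothLawSomeForce h)

end Summit.AnomalousDissipation.AnomalousDissipation.Theorems.GalerkinInvariantLoud.WorkLaw

end
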